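import Literature.AlgebraicGeometry.Resolution.HenselizedRationalTameExtensions
import Literature.AlgebraicGeometry.Resolution.NormalDegreePDefectlessVT
import Literature.AlgebraicGeometry.Resolution.GeneralizedStabilityRankOneVTSteps
import Literature.AlgebraicGeometry.Resolution.NormalDegreePDefectlessInseparable
import Literature.AlgebraicGeometry.Resolution.TameTowerPGroupTowers
import Mathlib.GroupTheory.Sylow
import Mathlib.FieldTheory.PrimitiveElement
import HarnessLib

/-!
# No proper immediate algebraic extensions of `K(x)^h`: the italicized statement of §5 from Hensel's Lemma and the degree-`p` facts (Kuhlmann 2010)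

Topic: `Literature/AlgebraicGeometry/Resolution` (valued function fields). Third layer, and
ASSEMBLY, of the decomposition of the named fact `Kuhlmann2010HenselizedRationalImmediateExt`
(`GeneralizedStabilityHenselizedRational.lean`) = the italicized statement on p. 19 of
F.-V. Kuhlmann, *Elimination of ramification I: The generalized stability theorem*, Trans. AMS
362 (2010) 5697–5727 = arXiv:1003.5678:

> *Henselized inertially generated function fields of rank 1 and of transcendence degree 1 with
> a valuation-transcendental generator over an algebraically closed ground field do not admit
> proper immediate algebraic extensions.*

for the henselized rational function field `F = K(x)^h` of rank one with a value-transcendental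
generator over an algebraically closed `K ≤ Ω`. The printed proof (pp. 18–19):

> Since the ramification group is a `p`-group (cf. [En]), `F^sep|F^r` is a `p`-extension. It
> follows from the general theory of `p`-groups … via Galois correspondence that the maximal
> separable subextension of `E.F^r|F^r` is a finite tower of Galois extensions of degree `p`.
> Consequently, `E.F^r|F^r` is a finite tower of normal extensions of degree `p`, either Galois
> or purely inseparable. Then there is already a finite subextension `N|F` of `F^r|F` such that
> `E.N|N` is such a tower. Lemma 2.27 shows that `N` … is again a henselized inertially generated
> function field … with a valuation-transcendental generator over `K`. Also, it is again of
> rank 1. By Proposition 2.18 we have `d(E|F,v) = d(E.N|N,v)` … Then the first extension in the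
> tower is defectless by Corollary 4.2 or Proposition 3.1. This yields
> `d(E|F,v) = d(E.N|N,v) < [E.N:N] ≤ [E:F]`, that is, `(E|F,v)` cannot be immediate.

Here the argument is run at the level of FINITE Galois theory inside `Ω`, from three named
facts only — Hensel's Lemma for henselian fields (`Kuhlmann2010HenselsLemma`, `HenselLift.lean`,
§1.1) and the degree-`p` steps Cor. 4.2 / Prop. 3.1 (`Kuhlmann2010GaloisDegreePDefectlessVT`,
`Kuhlmann2010PurelyInseparableDegreePDefectlessVT`, `NormalDegreePDefectlessVT.lean`) —, the
absolute ramification field, the Lemma of Ostrowski and Prop. 2.18 being replaced as follows.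
Let `E₁|F` be finite, separable and immediate, `M|F` its Galois closure in `Ω`, `G = Gal(M|F)`.

1. **Tame part** ("the ramification group is a `p`-group"): for a prime `ℓ` which is a unit of
   the residue field and an `ℓ`-Sylow subgroup `S` of `G`, `M` is reached from `Fix(S)` by a
   tower of Galois steps of degree `ℓ` (`isNormalPTower_of_isGalois_of_isPGroup`,
   `TameTowerPGroupTowers.lean`), each totally ramified (`relRamificationIndex_eq_of_isGalois_prime`,
   `HenselizedRationalTameExtensions.lean`: Kummer theory and Hensel's Lemma); so `|S| ∣ e(M|F)`
   (`card_sylow_dvd_relRamificationIndex`). If every prime dividing `|G|` is such a unit (e.g. in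
   residue characteristic `0`), `e(M|F) = [M : F]` and `E₁ = F` by the fundamental inequality.
2. Otherwise let `P` be a `p`-Sylow subgroup, `p` the residue characteristic, `T = Fix(P)`
   ("`N = M ∩ F^r`"): `e(M|T)` is a power of `p` (the norm argument
   `exists_valuation_pow_eq_of_isGalois`, `GeneralizedStabilityRankOneVTSteps.lean`), so by 1.
   `[T : F] ∣ e(T|F)`, i.e. `T|F` is TAME, and **Lemma 2.27** (`exists_eq_henselizedAdjoin_of_tame`)
   gives `T = K(y)^h` with `y` value-transcendental.
3. The compositum `L = E₁.T = Fix(Gal(M|E₁) ∩ P)` has `(vL : vF) ≤ [L : E₁] ≤ [T : F] = (vT : vF)`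
   (`relfinrank_sup_le_relfinrank`, `DefectAmbient.lean`), so `L|T` is IMMEDIATE and proper; being
   inside the `p`-extension `M|T` it starts with a normal step `N'|T` of degree `p`
   (`isNormalPTower_of_isGalois_of_isPGroup` again), immediate, which contradicts "the first
   extension in the tower is defectless by Corollary 4.2 or Proposition 3.1".
4. A finite purely inseparable immediate `E₀|F` is excluded in the same way through the tower of
   purely inseparable steps of degree `p` (`isNormalPTower_of_isPurelyInseparable`) and Prop. 3.1;
   a general algebraic immediate `E` is exhausted by the `F(a)`, `a ∈ E`.

## Content (everything PROVED)

* Bridges: `exists_extendScalars_ringEquiv`, `relFinrank_eq_relfinrank`,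
  `relFinite_of_relfinrank_pos`, `relfinrank_pos_of_relFinite`, `IsGaloisStep.rel`,
  `natCast_residueField_eq_zero`, `not_isDefectlessExtension_of_isImmediateOver`,
  `IsNormalPTower.exists_isNormalStep`, `relfinrank_lift_toSubfield`,
  `relfinrank_lift_toSubfield_top`, `relRamificationIndex_eq_relFinrank_of_le` (sandwich);
  immediateness of subextensions is `IsImmediateOver.mono_right`
  (`KnafKuhlmann2009Thm11Parts.lean`).
* `relRamificationIndex_eq_relFinrank_of_isNormalPTower` — along a tower of normal steps of prime
  degree `ℓ ≠ char Ωv` over a henselian field containing the algebraically closed `K`, `e` is the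
  degree.
* `card_sylow_dvd_relRamificationIndex` — `|S| ∣ e(M|F)` for an `ℓ`-Sylow subgroup `S` of the
  Galois group of `M|F`, `ℓ ≠ char Ωv`.
* `eq_bot_of_isImmediateOver_of_isSeparable` — steps 1–3: a finite separable immediate extension
  of `K(x)^h` (rank one, `x` value-transcendental, `K` algebraically closed) is trivial.
* `Kuhlmann2010HenselizedRationalImmediateExt.of_parts :
  Kuhlmann2010HenselsLemma → Kuhlmann2010GaloisDegreePDefectlessVT →
  Kuhlmann2010PurelyInseparableDegreePDefectlessVT → Kuhlmann2010HenselizedRationalImmediateExt`.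

After this file the trust base of `Kuhlmann2010HenselizedRationalImmediateExt` (and, through
`GeneralizedStabilityLemma55VT.lean` / `GeneralizedStabilityRankOneVTSteps.lean`, of the
value-transcendental case (R4) of Thm. 1.1) is {`Kuhlmann2010HenselsLemma` (§1.1, classical),
`Kuhlmann2010GaloisDegreePDefectlessVT` (Cor. 4.2: Props. 4.5–4.6),
`Kuhlmann2010PurelyInseparableDegreePDefectlessVT` (Prop. 3.1 with Thm. 2.14)}.

## Sources

* F.-V. Kuhlmann, *Elimination of ramification I: The generalized stability theorem*, Trans.
  Amer. Math. Soc. 362 (2010) 5697–5727 = arXiv:1003.5678: §1 (fundamental inequality), §1.1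
  (henselian fields), Lemma 2.1, Lemma 2.5, §2.5 (Lemmas 2.26–2.27), §3 Prop. 3.1, §4 Cor. 4.2,
  §5 (proof of (R4), pp. 18–20).
* Group theory (Sylow subgroups, `p`-groups) and Galois theory: Mathlib, in place of [H] =
  B. Huppert, *Endliche Gruppen I*, III §7, and [En] = O. Endler, *Valuation theory* (1972), §20.

## Rendering notes

* As in `GeneralizedStabilityRankOneVTPairs.lean` / `HenselizedFunctionFields.lean`: one
  algebraically closed valued field `(Ω, V)`, fields = `Subfield Ω`; the Galois closure `M` of a
  finite separable `E₁|F` is an `IntermediateField F Ω`, its subextensions are pushed into `Ω` by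
  `IntermediateField.lift` and rebased by the lemmas of `TameTowerRebase.lean`.
* The replacement of `F^r`, Ostrowski's lemma and Prop. 2.18 by the Sylow subgroups of a finite
  Galois closure (steps 1–3 above) is a routine finite-level variant of the printed argument and
  is tagged with the source's §5; no statement beyond the source's is claimed.
-/

noncomputable section

open IsLocalRing Module IntermediateField

namespace Literature.AlgebraicGeometry.Resolution

universe u

variable {Ω : Type u} [Field Ω] (V : ValuationSubring Ω)

/-! ### Bridges between the typed invariants of pairs and the ambient ones -/

section Bridges

variable {V}

/-- The identity `Subfield.extendScalars h ≃+* T` for subfields `M ≤ T` of `Ω` (both carrying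
the structure maps from `M`), as an existence statement. [folklore] -/
theorem exists_extendScalars_ringEquiv {M T : Subfield Ω} (h : M ≤ T) :
    letI : Algebra M T := (Subfield.inclusion h).toAlgebra
    ∃ e : Subfield.extendScalars h ≃+* T,
      (algebraMap M T).comp (RingEquiv.refl M).toRingHom =
        (e : Subfield.extendScalars h →+* T).comp (algebraMap M (Subfield.extendScalars h)) := by
  letI : Algebra M T := (Subfield.inclusion h).toAlgebra
  exact ⟨{ toFun := fun z => ⟨z.1, z.2⟩
           invFun := fun z => ⟨z.1, z.2⟩
           left_inv := fun _ => rfl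
           right_inv := fun _ => rfl
           map_mul' := fun _ _ => rfl
           map_add' := fun _ _ => rfl }, RingHom.ext fun _ => Subtype.ext rfl⟩

/-- `relFinrank M T h = Subfield.relfinrank M T` for `M ≤ T`. [folklore] -/
theorem relFinrank_eq_relfinrank {M T : Subfield Ω} (h : M ≤ T) :
    relFinrank M T h = Subfield.relfinrank M T := by
  rw [Subfield.relfinrank_eq_finrank_of_le h]
  letI : Algebra M T := (Subfield.inclusion h).toAlgebra
  obtain ⟨e, hc⟩ := exists_extendScalars_ringEquiv h
  unfold relFinrank
  exact (Algebra.finrank_eq_of_equiv_equiv (RingEquiv.refl M) e hc).symm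

/-- A pair `M ≤ T` with `[T : M] > 0` (in the sense of `Subfield.relfinrank`) is `RelFinite`.
[folklore] -/
theorem relFinite_of_relfinrank_pos {M T : Subfield Ω} (h : M ≤ T) (hpos : 0 < Subfield.relfinrank M T) :
    RelFinite M T h := by
  letI : Algebra M T := (Subfield.inclusion h).toAlgebra
  rw [← relFinrank_eq_relfinrank h] at hpos
  unfold RelFinite
  exact Module.finite_of_finrank_pos hpos

/-- `[T : M] > 0` for a `RelFinite` pair. [folklore] -/
theorem relfinrank_pos_of_relFinite {M T : Subfield Ω} (h : M ≤ T) (hfin : RelFinite M T h) :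
    0 < Subfield.relfinrank M T := by
  rw [← relFinrank_eq_relfinrank h]
  exact one_le_relFinrank h hfin

/-- A Galois step of degree `p > 0` in typed form: `RelFinite`, `relFinrank = p`, `IsGalois` for
the inclusion algebra. [folklore] -/
theorem IsGaloisStep.rel {p : ℕ} (hp : 0 < p) {M T : Subfield Ω} (hs : IsGaloisStep p M T) :
    ∃ h : M ≤ T, RelFinite M T h ∧ relFinrank M T h = p ∧
      (letI : Algebra M T := (Subfield.inclusion h).toAlgebra; IsGalois M T) := by
  obtain ⟨h, hdeg, hgal⟩ := hs
  letI : Algebra M T := (Subfield.inclusion h).toAlgebra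
  haveI : FiniteDimensional M (Subfield.extendScalars h) :=
    Module.finite_of_finrank_pos (by rw [hdeg]; exact hp)
  haveI := hgal
  obtain ⟨e, hc⟩ := exists_extendScalars_ringEquiv h
  refine ⟨h, ?_, ?_, ?_⟩
  · unfold RelFinite
    exact Module.Finite.of_equiv_equiv (RingEquiv.refl M) e hc
  · unfold relFinrank
    rw [← hdeg]
    exact (Algebra.finrank_eq_of_equiv_equiv (RingEquiv.refl M) e hc).symm
  · exact IsGalois.of_equiv_equiv (f := RingEquiv.refl M) (g := e) hc

/-- `n = 0` in `Ω` forces `n = 0` in the residue field `Ωv`. [folklore] -/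
theorem natCast_residueField_eq_zero {n : ℕ} (hn : (n : Ω) = 0) : (n : ResidueField V) = 0 := by
  have : ((n : V) : Ω) = 0 := by simpa using hn
  have h1 : (n : V) = 0 := Subtype.ext this
  have := congrArg (residue V) h1
  simpa using this

/-- An immediate extension is not a defectless extension of degree `> 1`. [folklore] -/
theorem not_isDefectlessExtension_of_isImmediateOver {N N' : Subfield Ω}
    (hd : IsDefectlessExtension V N N') (himm : IsImmediateOver V N N')
    (h1 : 1 < Subfield.relfinrank N N') : False := by
  obtain ⟨hle, -, heq⟩ := hd
  obtain ⟨hv, hr⟩ := himm.valueSubgroup_eq_and_residueSubfield_eq V hle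
  rw [hv, hr, Subgroup.relIndex_self, Subfield.relfinrank_self, mul_one] at heq
  omega

/-- A non-trivial tower of normal steps has a first step inside the tower. [folklore] -/
theorem IsNormalPTower.exists_isNormalStep {p : ℕ} {M T : Subfield Ω} (h : IsNormalPTower p M T)
    (hne : M ≠ T) : ∃ N' : Subfield Ω, IsNormalStep p M N' ∧ N' ≤ T := by
  cases h with
  | refl => exact absurd rfl hne
  | step hstep hrest => exact ⟨_, hstep, hrest.le⟩

end Bridges

/-! ### Towers of Galois steps of prime degree `ℓ ≠ p` are totally ramified -/

section TameTowers

variable {V}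

/-- **Along a tower of normal extensions of prime degree `ℓ ≠ char Ωv`, `e` equals the degree**:
for subfields `K ≤ M ≤ T` of the algebraically closed `(Ω, V)` with `K` algebraically closed,
`M` henselian, `Tv ⊆ Kv` and `IsNormalPTower ℓ M T` (every step is then Galois — a purely
inseparable step of degree `ℓ` would force `char Ω = ℓ` —, hence totally ramified by
`relRamificationIndex_eq_of_isGalois_prime`), `e(T|M) = [T : M]`. PROVED from Hensel's Lemma.
[cite: Kuhlmann2010, Section 5, proof of (R4) (p. 18)] -/
theorem relRamificationIndex_eq_relFinrank_of_isNormalPTower [IsAlgClosed Ω]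
    (hHL : Kuhlmann2010HenselsLemma.{u}) {ℓ : ℕ} (hℓ : ℓ.Prime) (hℓv : (ℓ : ResidueField V) ≠ 0)
    {K : Subfield Ω} (hK : IsAlgClosed K) {M T : Subfield Ω} (htow : IsNormalPTower ℓ M T) :
    K ≤ M → IsHenselianField M (V.comap (algebraMap M Ω)) → resField V T ≤ resField V K →
      ∃ h : M ≤ T, RelFinite M T h ∧ relRamificationIndex V M T h = relFinrank M T h := by
  induction htow with
  | refl M =>
    intro hKM hMh hres
    refine ⟨le_rfl, ?_, ?_⟩
    · exact relFinite_of_relfinrank_pos (le_refl M) (by rw [Subfield.relfinrank_self]; exact one_pos)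
    · rw [relRamificationIndex_eq_one_of_forall (le_refl M) (fun a ha _ => ⟨a, ha, rfl⟩),
        relFinrank_eq_relfinrank, Subfield.relfinrank_self]
  | @step M M₁ T hstep hrest ih =>
    intro hKM hMh hres
    haveI : Fact ℓ.Prime := ⟨hℓ⟩
    have hMM₁ : M ≤ M₁ := hstep.le
    have hM₁T : M₁ ≤ T := hrest.le
    -- the step is Galois (a purely inseparable step of degree `ℓ` would force `char Ω = ℓ`)
    have hgs : IsGaloisStep ℓ M M₁ := by
      rcases hstep.isGaloisStep_or_isPurelyInseparableStep hℓ with hg | hi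
      · exact hg
      · exfalso
        obtain ⟨h, hdeg, hpi⟩ := hi
        haveI := hpi
        haveI : CharP Ω ℓ := charP_of_purelyInseparable_of_finrank_eq hℓ (Subfield.extendScalars h) hdeg
        exact hℓv (natCast_residueField_eq_zero (V := V) (CharP.cast_eq_zero Ω ℓ))
    obtain ⟨h₁, hfin₁, hdeg₁, hgal₁⟩ := hgs.rel hℓ.pos
    -- `M₁` is henselian with residues in `Kv`
    have halg₁ : ∀ y ∈ M₁, IsAlgebraic M y := forall_isAlgebraic_of_relFinite h₁ hfin₁
    have hM₁h : IsHenselianField M₁ (V.comap (algebraMap M₁ Ω)) :=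
      IsHenselianField.of_subfield_algebraic V h₁ halg₁ hMh
    have hres₁ : resField V M₁ ≤ resField V K := (resField_mono V hM₁T).trans hres
    -- the step is totally ramified
    have he₁ : relRamificationIndex V M M₁ h₁ = ℓ :=
      relRamificationIndex_eq_of_isGalois_prime hK hKM h₁ (hHL M _ hMh) hres₁ hfin₁ hgal₁ hℓ hℓv hdeg₁
    -- induction
    obtain ⟨h₂, hfin₂, he₂⟩ := ih (hKM.trans h₁) hM₁h hres
    refine ⟨h₁.trans h₂, (relFinite_tower_iff h₁ h₂).mpr ⟨hfin₁, hfin₂⟩, ?_⟩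
    obtain ⟨hte, -, htn⟩ := rel_tower (V := V) h₁ h₂
    rw [hte, htn, he₁, hdeg₁, he₂]

end TameTowers

/-! ### Invariants of the Galois closure: fixed fields as subfields of `Ω` -/

section GaloisClosure

variable {V} {F : Subfield Ω} {M : IntermediateField F Ω}

/-- `[lift K : F] = [K : F]` for an intermediate field `K` of `M|F`, pushed into `Ω`. [folklore] -/
theorem relfinrank_lift_toSubfield (K : IntermediateField F M) :
    Subfield.relfinrank F (lift K).toSubfield = finrank F K := by
  rw [relfinrank_toSubfield_eq_finrank]
  exact (liftAlgEquiv K).toLinearEquiv.finrank_eq.symm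

/-- `[M : lift K] = [M : K]` for an intermediate field `K` of the finite extension `M|F`.
[folklore] -/
theorem relfinrank_lift_toSubfield_top [FiniteDimensional F M] (K : IntermediateField F M) :
    Subfield.relfinrank (lift K).toSubfield M.toSubfield = finrank K M := by
  have h1 := Subfield.relfinrank_mul_relfinrank (le_lift_toSubfield K) (lift_toSubfield_le K)
  rw [relfinrank_lift_toSubfield, relfinrank_toSubfield_eq_finrank,
    ← Module.finrank_mul_finrank F K M] at h1
  exact Nat.eq_of_mul_eq_mul_left finrank_pos h1

/-- **The `ℓ`-part of `[M : F]` divides `e(M|F)`** for `ℓ ≠ char Ωv`: for `M|F` finite Galois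
over a henselian `F ⊇ K` (`K` algebraically closed) with `Mv ⊆ Kv`, and an `ℓ`-Sylow subgroup
`S` of `Gal(M|F)`, `|S| ∣ e(M|F)` — `M` is reached from the fixed field of `S` by a tower of
Galois steps of degree `ℓ`, each totally ramified. PROVED from Hensel's Lemma.
[cite: Kuhlmann2010, Section 5, proof of (R4) (p. 18)] -/
theorem card_sylow_dvd_relRamificationIndex [IsAlgClosed Ω] (hHL : Kuhlmann2010HenselsLemma.{u})
    {ℓ : ℕ} [Fact ℓ.Prime] (hℓv : (ℓ : ResidueField V) ≠ 0) {K : Subfield Ω} (hK : IsAlgClosed K)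
    (hKF : K ≤ F) [FiniteDimensional F M] [IsGalois F M]
    (hFh : IsHenselianField F (V.comap (algebraMap F Ω)))
    (hres : resField V M.toSubfield ≤ resField V K) (S : Sylow ℓ (M ≃ₐ[F] M)) :
    Nat.card S ∣ relRamificationIndex V F M.toSubfield (subfield_le_toSubfield M) := by
  set TK : IntermediateField F M := fixedField (S : Subgroup (M ≃ₐ[F] M)) with hTKdef
  set T : Subfield Ω := (lift TK).toSubfield with hTdef
  have hFT : F ≤ T := le_lift_toSubfield TK
  have hTM : T ≤ M.toSubfield := lift_toSubfield_le TK
  -- rebase `M` over `T`: finite Galois with an `ℓ`-group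
  haveI := finiteDimensional_extendScalars_lift TK
  haveI := isGalois_extendScalars_lift TK
  have hP : IsPGroup ℓ (Subfield.extendScalars (lift_toSubfield_le TK) ≃ₐ[(lift TK).toSubfield]
      Subfield.extendScalars (lift_toSubfield_le TK)) := by
    refine isPGroup_extendScalars_lift TK ?_
    rw [hTKdef, fixingSubgroup_fixedField]
    exact S.isPGroup'
  have htow : IsNormalPTower ℓ T M.toSubfield := by
    have := isNormalPTower_top_of_isGalois_of_isPGroup (lift TK).toSubfield
      (Subfield.extendScalars (lift_toSubfield_le TK)) hP
    rwa [Subfield.extendScalars_toSubfield] at this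
  -- `T` is henselian, finite over `F`
  have hfinFT : RelFinite F T hFT := relFinite_of_relfinrank_pos hFT
    (by rw [hTdef, relfinrank_lift_toSubfield]; exact finrank_pos)
  have hTh : IsHenselianField T (V.comap (algebraMap T Ω)) :=
    IsHenselianField.of_subfield_algebraic V hFT (forall_isAlgebraic_of_relFinite hFT hfinFT) hFh
  obtain ⟨hTM', -, he⟩ := relRamificationIndex_eq_relFinrank_of_isNormalPTower hHL Fact.out hℓv
    hK htow (hKF.trans hFT) hTh hres
  -- `e(M|T) = [M : T] = |S|`
  have hdeg : relFinrank T M.toSubfield hTM = Nat.card S := by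
    rw [relFinrank_eq_relfinrank, hTdef, relfinrank_lift_toSubfield_top, hTKdef,
      finrank_fixedField_eq_card]
  obtain ⟨hte, -, -⟩ := rel_tower (V := V) hFT hTM
  have he' : relRamificationIndex V T M.toSubfield hTM = Nat.card S := by rw [← hdeg]; exact he
  refine ⟨relRamificationIndex V F T hFT, ?_⟩
  have : relRamificationIndex V F M.toSubfield (subfield_le_toSubfield M) =
      relRamificationIndex V F T hFT * relRamificationIndex V T M.toSubfield hTM := hte
  rw [this, he', mul_comm]

end GaloisClosure

/-! ### The italicized statement of §5 for `K(x)^h` -/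

section Assembly

variable {V}

/-- **Sandwich**: if `e(B|F) = [B : F]` for `F ≤ A ≤ B` finite, then `e(A|F) = [A : F]`
(multiplicativity and the fundamental inequality). [folklore] -/
theorem relRamificationIndex_eq_relFinrank_of_le {F A B : Subfield Ω} (hFA : F ≤ A) (hAB : A ≤ B)
    (hfin : RelFinite F B (hFA.trans hAB))
    (he : relRamificationIndex V F B (hFA.trans hAB) = relFinrank F B (hFA.trans hAB)) :
    relRamificationIndex V F A hFA = relFinrank F A hFA := by
  obtain ⟨hfin₁, hfin₂⟩ := (relFinite_tower_iff hFA hAB).mp hfin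
  obtain ⟨hte, -, htn⟩ := rel_tower (V := V) hFA hAB
  have h₁ := relRamificationIndex_mul_relInertiaDegree_le (V := V) hFA hfin₁
  have h₂ := relRamificationIndex_mul_relInertiaDegree_le (V := V) hAB hfin₂
  obtain ⟨he₁, hf₁⟩ := one_le_relRamificationIndex_and_relInertiaDegree (V := V) hFA hfin₁
  obtain ⟨he₂, hf₂⟩ := one_le_relRamificationIndex_and_relInertiaDegree (V := V) hAB hfin₂
  have hn₁ := one_le_relFinrank hFA hfin₁
  have hn₂ := one_le_relFinrank hAB hfin₂
  rw [hte, htn] at he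
  have h₁' : relRamificationIndex V F A hFA ≤ relFinrank F A hFA := by nlinarith
  have h₂' : relRamificationIndex V A B hAB ≤ relFinrank A B hAB := by nlinarith
  nlinarith

/-- **The italicized statement of §5 for finite separable extensions of `K(x)^h`**: for `K`
algebraically closed, `x` value-transcendental, `F = K(x)^h` of rank one, a finite separable
intermediate field `E₁` of `Ω|F` which is immediate over `F` is trivial. This is the heart of
the printed argument (pp. 18–19), run at the level of finite Galois theory: in the Galois closure
`M|F` of `E₁|F`, the `ℓ`-Sylow subgroups for `ℓ ≠ p` show that the fixed field `T` of a
`p`-Sylow subgroup is TAME over `F` (`card_sylow_dvd_relRamificationIndex`, and the norm argument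
`exists_valuation_pow_eq_of_isGalois` for the `p`-extension `M|T`), hence `T = K(y)^h`
(Lemma 2.27); the compositum `L = E₁.T` is a proper IMMEDIATE subextension of the `p`-extension
`M|T`, so it contains a normal extension `N'|T` of degree `p` ("a finite tower of normal
extensions of degree `p`", `isNormalPTower_of_isGalois_of_isPGroup`), again immediate,
contradicting "the first extension in the tower is defectless by Corollary 4.2 or
Proposition 3.1" (`Kuhlmann2010GaloisDegreePDefectlessVT`,
`Kuhlmann2010PurelyInseparableDegreePDefectlessVT`). In residue characteristic `0` — more
generally when no prime dividing `[M : F]` vanishes in `Ωv` — all of `M|F` is tame and `E₁ = F`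
directly. PROVED from the three named facts. [cite: Kuhlmann2010, Section 5, proof of (R4) (pp. 18–19)] -/
theorem eq_bot_of_isImmediateOver_of_isSeparable [IsAlgClosed Ω]
    (hHL : Kuhlmann2010HenselsLemma.{u}) (hG : Kuhlmann2010GaloisDegreePDefectlessVT.{u})
    (hI : Kuhlmann2010PurelyInseparableDegreePDefectlessVT.{u})
    {K : Subfield Ω} (hK : IsAlgClosed K) {x : Ω} (hx : IsValueTranscendentalOver V K x)
    {F : Subfield Ω} (hF : F = henselizedAdjoin V K x) (hr : IsRankOneValued V F)
    (E₁ : IntermediateField F Ω) [FiniteDimensional F E₁] [Algebra.IsSeparable F E₁]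
    (himm : IsImmediateOver V F E₁.toSubfield) : E₁ = ⊥ := by
  classical
  have hKxF : (IntermediateField.adjoin K ({x} : Set Ω)).toSubfield ≤ F :=
    hF ▸ adjoin_le_henselizedAdjoin V K x
  have hKF : K ≤ F := hF ▸ le_henselizedAdjoin V K x
  have hFh : IsHenselianField F (V.comap (algebraMap F Ω)) := by
    subst hF
    exact isHenselianField_henselizedAdjoin Kuhlmann2010HenselizationIsHenselian_holds K x
  by_contra hE₁
  ---------------------------------------------------------------- the Galois closure `M` of `E₁|F`
  obtain ⟨α, hα⟩ := Field.exists_primitive_element F E₁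
  have hint : IsIntegral F α := Algebra.IsIntegral.isIntegral α
  have hfsep : (minpoly F α).Separable := Algebra.IsSeparable.isSeparable F α
  have hf0 : minpoly F α ≠ 0 := minpoly.ne_zero hint
  obtain ⟨M, hMdef⟩ : ∃ M : IntermediateField F Ω,
      M = IntermediateField.adjoin F ((minpoly F α).rootSet Ω) := ⟨_, rfl⟩
  haveI : (minpoly F α).IsSplittingField F M := by
    rw [hMdef]
    exact IntermediateField.adjoin_rootSet_isSplittingField
      (IsAlgClosed.splits ((minpoly F α).map (algebraMap F Ω)))
  haveI : FiniteDimensional F M := Polynomial.IsSplittingField.finiteDimensional M (minpoly F α)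
  haveI : IsGalois F M := IsGalois.of_separable_splitting_field hfsep
  -- `E₁ = F(α) ≤ M`
  have hE₁eq : E₁ = IntermediateField.adjoin F ({(α : Ω)} : Set Ω) := by
    have h := lift_adjoin_simple F E₁ α
    rw [hα, lift_top] at h
    exact h
  have hαroot : (α : Ω) ∈ (minpoly F α).rootSet Ω := by
    rw [Polynomial.mem_rootSet_of_ne hf0]
    have h := minpoly.aeval F α
    have := congrArg (algebraMap E₁ Ω) h
    rwa [map_zero, ← Polynomial.aeval_algebraMap_apply] at this
  have hE₁M : E₁ ≤ M := by
    rw [hE₁eq, hMdef]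
    exact IntermediateField.adjoin.mono F _ _ (Set.singleton_subset_iff.mpr hαroot)
  obtain ⟨KE, hKEdef⟩ : ∃ KE : IntermediateField F M, KE = IntermediateField.restrict hE₁M :=
    ⟨_, rfl⟩
  have hKE : lift KE = E₁ := by rw [hKEdef]; exact lift_restrict hE₁M
  have hFZ : F ≤ M.toSubfield := subfield_le_toSubfield M
  have hE₁s : E₁.toSubfield = (lift KE).toSubfield := by rw [hKE]
  have hFE₁ : F ≤ E₁.toSubfield := subfield_le_toSubfield E₁
  have hE₁Z : E₁.toSubfield ≤ M.toSubfield := fun y hy => hE₁M hy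
  ---------------------------------------------------------------- finiteness, residues, degrees
  have hfinFZ : RelFinite F M.toSubfield hFZ := relFinite_of_relfinrank_pos hFZ
    (by rw [relfinrank_toSubfield_eq_finrank]; exact finrank_pos)
  have halgZ : ∀ a ∈ M.toSubfield, IsAlgebraic (IntermediateField.adjoin K ({x} : Set Ω)).toSubfield a := by
    intro a ha
    subst hF
    exact isAlgebraic_toSubfield_of_isAlgebraic (isAlgebraic_adjoin_of_relFinite hFZ hfinFZ ha)
  have hresZ : resField V M.toSubfield ≤ resField V K :=
    resField_le_of_forall_isAlgebraic V hK (resField_adjoin_le hx) halgZ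
  have heE₁ : relRamificationIndex V F E₁.toSubfield hFE₁ = 1 :=
    relRamificationIndex_eq_one_of_forall hFE₁ himm.1
  have hdegE₁ : 1 < relFinrank F E₁.toSubfield hFE₁ := by
    rw [relFinrank_eq_relfinrank, relfinrank_toSubfield_eq_finrank]
    have h1 : finrank F E₁ ≠ 1 := fun h => hE₁ (IntermediateField.finrank_eq_one_iff.mp h)
    have h2 : 0 < finrank F E₁ := finrank_pos
    omega
  have hcardG : Nat.card (M ≃ₐ[F] M) = finrank F M := IsGalois.card_aut_eq_finrank F M
  have hnZ : relFinrank F M.toSubfield hFZ = Nat.card (M ≃ₐ[F] M) := by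
    rw [hcardG, relFinrank_eq_relfinrank, relfinrank_toSubfield_eq_finrank]
  have heZle : relRamificationIndex V F M.toSubfield hFZ ≤ relFinrank F M.toSubfield hFZ := by
    have h := relRamificationIndex_mul_relInertiaDegree_le (V := V) hFZ hfinFZ
    obtain ⟨-, hf⟩ := one_le_relRamificationIndex_and_relInertiaDegree (V := V) hFZ hfinFZ
    nlinarith
  have heZpos : 0 < relRamificationIndex V F M.toSubfield hFZ :=
    (one_le_relRamificationIndex_and_relInertiaDegree (V := V) hFZ hfinFZ).1
  -- Sylow: the `ℓ`-part of `|G|` divides `e(M|F)` for `ℓ` a unit of the residue field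
  have hsyl : ∀ (ℓ k : ℕ), ℓ.Prime → (ℓ : ResidueField V) ≠ 0 → ℓ ^ k ∣ Nat.card (M ≃ₐ[F] M) →
      ℓ ^ k ∣ relRamificationIndex V F M.toSubfield hFZ := by
    intro ℓ k hℓ hℓv hk
    haveI : Fact ℓ.Prime := ⟨hℓ⟩
    obtain ⟨S⟩ : Nonempty (Sylow ℓ (M ≃ₐ[F] M)) := inferInstance
    have hS : Nat.card S = ℓ ^ (Nat.card (M ≃ₐ[F] M)).factorization ℓ := Sylow.card_eq_multiplicity S
    have hkle : k ≤ (Nat.card (M ≃ₐ[F] M)).factorization ℓ :=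
      (hℓ.pow_dvd_iff_le_factorization Nat.card_pos.ne').mp hk
    calc ℓ ^ k ∣ ℓ ^ (Nat.card (M ≃ₐ[F] M)).factorization ℓ := pow_dvd_pow ℓ hkle
      _ = Nat.card S := hS.symm
      _ ∣ relRamificationIndex V F M.toSubfield hFZ :=
        card_sylow_dvd_relRamificationIndex hHL hℓv hK hKF hFh hresZ S
  -- `E₁ ≤ T` is impossible for a tame `T|F` (sandwich)
  have key : ∀ {T : Subfield Ω} (hFT : F ≤ T) (_ : E₁.toSubfield ≤ T), RelFinite F T hFT →
      relRamificationIndex V F T hFT = relFinrank F T hFT → False := by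
    intro T hFT hE₁T hfinT heT
    have h := relRamificationIndex_eq_relFinrank_of_le hFE₁ hE₁T hfinT heT
    rw [heE₁] at h
    omega
  ---------------------------------------------------------------- case distinction on the residue characteristic
  by_cases htame : ∀ ℓ : ℕ, ℓ.Prime → ℓ ∣ Nat.card (M ≃ₐ[F] M) → (ℓ : ResidueField V) ≠ 0
  · -- every prime dividing `|G|` is a unit of the residue field: `M|F` is tame
    have hdvd : Nat.card (M ≃ₐ[F] M) ∣ relRamificationIndex V F M.toSubfield hFZ := by
      refine (Nat.dvd_iff_prime_pow_dvd_dvd _ _).mpr fun ℓ k hℓ hk => ?_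
      rcases Nat.eq_zero_or_pos k with rfl | hkpos
      · simp
      · exact hsyl ℓ k hℓ (htame ℓ hℓ (dvd_trans (dvd_pow_self ℓ hkpos.ne') hk)) hk
    have heZ : relRamificationIndex V F M.toSubfield hFZ = relFinrank F M.toSubfield hFZ :=
      le_antisymm heZle (by rw [hnZ]; exact Nat.le_of_dvd heZpos hdvd)
    exact key hFZ hE₁Z hfinFZ heZ
  · -- the residue characteristic `p` divides `|G|`
    push Not at htame
    obtain ⟨p, hp, hpG, hpv⟩ := htame
    haveI : Fact p.Prime := ⟨hp⟩
    haveI : CharP (ResidueField V) p := by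
      have h := ringChar.dvd hpv
      rcases (Nat.dvd_prime hp).mp h with h1 | h1
      · exact absurd h1 CharP.ringChar_ne_one
      · exact ringChar.of_eq h1
    obtain ⟨P⟩ : Nonempty (Sylow p (M ≃ₐ[F] M)) := inferInstance
    obtain ⟨TK, hTKdef⟩ : ∃ TK : IntermediateField F M, TK = fixedField (P : Subgroup (M ≃ₐ[F] M)) :=
      ⟨_, rfl⟩
    have hFT : F ≤ (lift TK).toSubfield := le_lift_toSubfield TK
    have hTZ : (lift TK).toSubfield ≤ M.toSubfield := lift_toSubfield_le TK
    haveI : (P : Subgroup (M ≃ₐ[F] M)).FiniteIndex := Subgroup.finiteIndex_of_finite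
    have hpm : ¬ p ∣ (P : Subgroup (M ≃ₐ[F] M)).index := P.not_dvd_index
    have hmG : (P : Subgroup (M ≃ₐ[F] M)).index ∣ Nat.card (M ≃ₐ[F] M) := Subgroup.index_dvd_card _
    have hm0 : 0 < (P : Subgroup (M ≃ₐ[F] M)).index := Nat.pos_of_ne_zero Subgroup.FiniteIndex.index_ne_zero
    have hTKfix : TK.fixingSubgroup = (P : Subgroup (M ≃ₐ[F] M)) := by
      rw [hTKdef, fixingSubgroup_fixedField]
    -- degrees
    have hnT : relFinrank F (lift TK).toSubfield hFT = (P : Subgroup (M ≃ₐ[F] M)).index := by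
      rw [relFinrank_eq_relfinrank, relfinrank_lift_toSubfield,
        IntermediateField.finrank_eq_fixingSubgroup_index, hTKfix]
    have hfinFT : RelFinite F (lift TK).toSubfield hFT :=
      relFinite_of_relfinrank_pos hFT (by rw [← relFinrank_eq_relfinrank hFT, hnT]; exact hm0)
    have halgT := forall_isAlgebraic_of_relFinite hFT hfinFT
    have hTh : IsHenselianField (lift TK).toSubfield (V.comap (algebraMap (lift TK).toSubfield Ω)) :=
      IsHenselianField.of_subfield_algebraic V hFT halgT hFh
    have hTZcard : finrank TK M = Nat.card P := by rw [hTKdef]; exact finrank_fixedField_eq_card _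
    -- `M|T` is Galois with group `P`: `e(M|T)` is a power of `p`
    haveI := finiteDimensional_extendScalars_lift TK
    haveI := isGalois_extendScalars_lift TK
    have hgs : IsGaloisStep (Nat.card P) (lift TK).toSubfield M.toSubfield := by
      refine ⟨hTZ, ?_, ?_⟩
      · have h := finrank_extendScalars_lift TK
        rw [hTZcard] at h
        exact h
      · exact isGalois_extendScalars_lift TK
    obtain ⟨hTZ', hfinTZ, hdegTZ, hgalTZ⟩ := hgs.rel Nat.card_pos
    obtain ⟨kP, hkP⟩ : ∃ k : ℕ, Nat.card P = p ^ k := P.isPGroup'.exists_card_eq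
    have hpowZ : ∀ y ∈ M.toSubfield, y ≠ 0 →
        ∃ k : ℕ, ∃ c ∈ (lift TK).toSubfield, V.valuation y ^ p ^ k = V.valuation c := by
      intro y hy _
      obtain ⟨c, hc, hyc⟩ := exists_valuation_pow_eq_of_isGalois hTZ' hTh hfinTZ hgalTZ hy
      exact ⟨kP, c, hc, by rw [← hkP, ← hdegTZ]; exact hyc⟩
    obtain ⟨j, hj⟩ := exists_relRamificationIndex_eq_pow hTZ' hfinTZ hp hpowZ
    -- `m = [T : F]` divides `e(T|F)`
    obtain ⟨hteT, -, -⟩ := rel_tower (V := V) hFT hTZ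
    have heZsplit : relRamificationIndex V F M.toSubfield hFZ =
        relRamificationIndex V F (lift TK).toSubfield hFT * p ^ j := by rw [← hj]; exact hteT
    have hmdvd : (P : Subgroup (M ≃ₐ[F] M)).index ∣ relRamificationIndex V F (lift TK).toSubfield hFT := by
      refine (Nat.dvd_iff_prime_pow_dvd_dvd _ _).mpr fun ℓ k hℓ hk => ?_
      rcases Nat.eq_zero_or_pos k with rfl | hkpos
      · simp
      · have hℓp : ℓ ≠ p := by
          rintro rfl
          exact hpm (dvd_trans (dvd_pow_self ℓ hkpos.ne') hk)
        have hℓv : (ℓ : ResidueField V) ≠ 0 := fun h0 =>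
          hℓp ((Nat.prime_dvd_prime_iff_eq hp hℓ).mp ((CharP.cast_eq_zero_iff _ p ℓ).mp h0)).symm
        have h1 : ℓ ^ k ∣ relRamificationIndex V F M.toSubfield hFZ :=
          hsyl ℓ k hℓ hℓv (dvd_trans hk hmG)
        rw [heZsplit] at h1
        exact (Nat.Coprime.pow k j ((Nat.coprime_primes hℓ hp).mpr hℓp)).dvd_of_dvd_mul_right h1
    have heTle : relRamificationIndex V F (lift TK).toSubfield hFT ≤ relFinrank F (lift TK).toSubfield hFT := by
      have h := relRamificationIndex_mul_relInertiaDegree_le (V := V) hFT hfinFT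
      obtain ⟨-, hf⟩ := one_le_relRamificationIndex_and_relInertiaDegree (V := V) hFT hfinFT
      nlinarith
    have heTpos : 0 < relRamificationIndex V F (lift TK).toSubfield hFT :=
      (one_le_relRamificationIndex_and_relInertiaDegree (V := V) hFT hfinFT).1
    have heT : relRamificationIndex V F (lift TK).toSubfield hFT = relFinrank F (lift TK).toSubfield hFT :=
      le_antisymm heTle (by rw [hnT]; exact Nat.le_of_dvd heTpos hmdvd)
    ------------------------------------------------------------ Lemma 2.27: `T = K(y)^h`
    have hmv : ((relFinrank F (lift TK).toSubfield hFT : ℕ) : ResidueField V) ≠ 0 := by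
      rw [hnT]
      exact fun h0 => hpm ((CharP.cast_eq_zero_iff _ p _).mp h0)
    obtain ⟨y, hyT, hy, hTeq⟩ : ∃ y ∈ (lift TK).toSubfield, IsValueTranscendentalOver V K y ∧
        (lift TK).toSubfield = henselizedAdjoin V K y := by
      subst hF
      exact exists_eq_henselizedAdjoin_of_tame hHL hK hx hFT hfinFT heT hmv
    have hrT : IsRankOneValued V (henselizedAdjoin V K y) :=
      hTeq ▸ hr.of_algebraic V hFT halgT
    ------------------------------------------------------------ the compositum `L = E₁ T`
    have hTL : (lift TK).toSubfield ≤ (lift (KE ⊔ TK)).toSubfield := by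
      intro z hz
      rw [lift_sup, sup_toSubfield]
      exact (le_sup_right : (lift TK).toSubfield ≤ (lift KE).toSubfield ⊔ (lift TK).toSubfield) hz
    have hE₁L : E₁.toSubfield ≤ (lift (KE ⊔ TK)).toSubfield := by
      intro z hz
      rw [lift_sup, sup_toSubfield]
      rw [hE₁s] at hz
      exact (le_sup_left : (lift KE).toSubfield ≤ (lift KE).toSubfield ⊔ (lift TK).toSubfield) hz
    have hLZ : (lift (KE ⊔ TK)).toSubfield ≤ M.toSubfield := lift_toSubfield_le _
    have hLsup : (lift (KE ⊔ TK)).toSubfield = E₁.toSubfield ⊔ (lift TK).toSubfield := by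
      rw [lift_sup, sup_toSubfield, hE₁s]
    -- `[L : E₁] ≤ [T : F] = m`
    have hfinFL : RelFinite F (lift (KE ⊔ TK)).toSubfield (hFT.trans hTL) :=
      ((relFinite_tower_iff (hFT.trans hTL) hLZ).mp hfinFZ).1
    have hfinE₁L : RelFinite E₁.toSubfield (lift (KE ⊔ TK)).toSubfield hE₁L :=
      ((relFinite_tower_iff hFE₁ hE₁L).mp hfinFL).2
    have hfinTL : RelFinite (lift TK).toSubfield (lift (KE ⊔ TK)).toSubfield hTL :=
      ((relFinite_tower_iff hFT hTL).mp hfinFL).2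
    have hdegL : relFinrank E₁.toSubfield (lift (KE ⊔ TK)).toSubfield hE₁L ≤
        (P : Subgroup (M ≃ₐ[F] M)).index := by
      rw [relFinrank_eq_relfinrank, hLsup, ← hnT, relFinrank_eq_relfinrank]
      exact relfinrank_sup_le_relfinrank hFE₁ hFT
        (relfinrank_pos_of_relFinite hFT hfinFT).ne'
    -- `e(L|T) = 1`: `m · e(L|T) = e(L|F) = e(L|E₁) ≤ [L : E₁] ≤ m`
    obtain ⟨hte1, -, -⟩ := rel_tower (V := V) hFE₁ hE₁L
    obtain ⟨hte2, -, -⟩ := rel_tower (V := V) hFT hTL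
    have hfundE₁L := relRamificationIndex_mul_relInertiaDegree_le (V := V) hE₁L hfinE₁L
    obtain ⟨-, hfE₁L⟩ := one_le_relRamificationIndex_and_relInertiaDegree (V := V) hE₁L hfinE₁L
    obtain ⟨heTL1, -⟩ := one_le_relRamificationIndex_and_relInertiaDegree (V := V) hTL hfinTL
    have heq12 : relRamificationIndex V F E₁.toSubfield hFE₁ *
        relRamificationIndex V E₁.toSubfield (lift (KE ⊔ TK)).toSubfield hE₁L =
        relRamificationIndex V F (lift TK).toSubfield hFT *
          relRamificationIndex V (lift TK).toSubfield (lift (KE ⊔ TK)).toSubfield hTL := by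
      rw [← hte1]; exact hte2
    rw [heE₁, one_mul, heT, hnT] at heq12
    have heLT : relRamificationIndex V (lift TK).toSubfield (lift (KE ⊔ TK)).toSubfield hTL = 1 := by
      by_contra hne
      have h2 : 2 ≤ relRamificationIndex V (lift TK).toSubfield (lift (KE ⊔ TK)).toSubfield hTL := by
        omega
      nlinarith
    ------------------------------------------------------------ `L|T` is immediate and proper
    have himmL : IsImmediateOver V (lift TK).toSubfield (lift (KE ⊔ TK)).toSubfield :=
      ⟨exists_valuation_eq_of_relRamificationIndex_eq_one hTL heLT,
        (resField_mono V hLZ).trans (hresZ.trans (resField_mono V (hKF.trans hFT)))⟩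
    have hLne : (lift (KE ⊔ TK)).toSubfield ≠ (lift TK).toSubfield := fun hLT =>
      key hFT (hLT ▸ hE₁L) hfinFT heT
    ------------------------------------------------------------ a tower from `T` to `L` inside the `p`-extension `M|T`
    have hPgrp : IsPGroup p (Subfield.extendScalars (lift_toSubfield_le TK) ≃ₐ[(lift TK).toSubfield]
        Subfield.extendScalars (lift_toSubfield_le TK)) := by
      refine isPGroup_extendScalars_lift TK ?_
      rw [hTKfix]
      exact P.isPGroup'
    obtain ⟨K', hK'⟩ := exists_rebase_intermediateField TK (KE ⊔ TK) le_sup_right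
    have htowL : IsNormalPTower p (lift TK).toSubfield (lift (KE ⊔ TK)).toSubfield := by
      have h := isNormalPTower_of_isGalois_of_isPGroup (p := p)
        (finrank (lift TK).toSubfield (Subfield.extendScalars (lift_toSubfield_le TK)))
        (lift TK).toSubfield (Subfield.extendScalars (lift_toSubfield_le TK)) hPgrp rfl K'
      rwa [hK'] at h
    -- the first step of the tower
    obtain ⟨N', hstep, hN'L⟩ : ∃ N' : Subfield Ω, IsNormalStep p (lift TK).toSubfield N' ∧
        N' ≤ (lift (KE ⊔ TK)).toSubfield := by
      exact htowL.exists_isNormalStep hLne.symm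
    ------------------------------------------------------------ the first step is defectless and immediate
    rw [hTeq] at hstep
    have hd := isDefectlessExtension_of_isNormalStep_henselizedAdjoin hG hI V hp hK hy hrT hstep
    have himmN' : IsImmediateOver V (henselizedAdjoin V K y) N' :=
      hTeq ▸ IsImmediateOver.mono_right (V := V) hN'L himmL
    exact not_isDefectlessExtension_of_isImmediateOver hd himmN'
      (by rw [hstep.relfinrank_eq]; exact hp.one_lt)

/-- **Kuhlmann 2010, §5, the italicized statement (p. 19) for henselized rational function fields
with a value-transcendental generator — `Kuhlmann2010HenselizedRationalImmediateExt` from its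
parts.** "*Henselized inertially generated function fields of rank 1 and of transcendence degree
1 with a valuation-transcendental generator over an algebraically closed ground field do not
admit proper immediate algebraic extensions.*" For `F = K(x)^h` of rank one, `x`
value-transcendental over the algebraically closed `K ≤ Ω`: an element `a` of an immediate
algebraic extension `E` outside `F` generates a finite immediate `E₀ = F(a)`; if `E₀|F` is
purely inseparable, the first step of the tower of purely inseparable steps of degree `p` from
`F` to `E₀` (`isNormalPTower_of_isPurelyInseparable`) is immediate, against Prop. 3.1
(`Kuhlmann2010PurelyInseparableDegreePDefectlessVT`); otherwise the maximal separable
subextension is a finite separable immediate extension, trivial by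
`eq_bot_of_isImmediateOver_of_isSeparable`. PROVED from Hensel's Lemma for henselian fields
(`Kuhlmann2010HenselsLemma`, §1.1) and the degree-`p` facts Cor. 4.2 / Prop. 3.1
(`Kuhlmann2010GaloisDegreePDefectlessVT`, `Kuhlmann2010PurelyInseparableDegreePDefectlessVT`).
[cite: Kuhlmann2010, Section 5, proof of Thm. 1.1 (p. 19)] -/
theorem Kuhlmann2010HenselizedRationalImmediateExt.of_parts
    (hHL : Kuhlmann2010HenselsLemma.{u}) (hG : Kuhlmann2010GaloisDegreePDefectlessVT.{u})
    (hI : Kuhlmann2010PurelyInseparableDegreePDefectlessVT.{u}) :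
    Kuhlmann2010HenselizedRationalImmediateExt.{u} := by
  intro Ω _ _ V K hK x hx hr E hFE halg himm
  classical
  by_contra hne
  obtain ⟨a, haE, haF⟩ : ∃ a ∈ E, a ∉ henselizedAdjoin V K x := by
    by_contra h
    push Not at h
    exact hne (le_antisymm (fun z hz => h z hz) hFE)
  -- the finite immediate extension `E₀ = F(a)`
  obtain ⟨E₀, hE₀def⟩ : ∃ E₀ : IntermediateField (henselizedAdjoin V K x) Ω,
      E₀ = IntermediateField.adjoin (henselizedAdjoin V K x) ({a} : Set Ω) := ⟨_, rfl⟩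
  haveI : FiniteDimensional (henselizedAdjoin V K x) E₀ := by
    rw [hE₀def]
    exact IntermediateField.adjoin.finiteDimensional (halg a haE).isIntegral
  have hE₀E : E₀.toSubfield ≤ E := by
    have h : E₀ ≤ Subfield.extendScalars hFE := by
      rw [hE₀def]
      exact IntermediateField.adjoin_le_iff.mpr (Set.singleton_subset_iff.mpr haE)
    exact fun z hz => h hz
  have haE₀ : a ∈ E₀ := by
    rw [hE₀def]
    exact IntermediateField.subset_adjoin _ _ (Set.mem_singleton a)
  have himm₀ : IsImmediateOver V (henselizedAdjoin V K x) E₀.toSubfield :=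
    IsImmediateOver.mono_right hE₀E himm
  -- it suffices that `E₀ = F`
  suffices hbot : E₀ = ⊥ by
    apply haF
    have ha : a ∈ (⊥ : IntermediateField (henselizedAdjoin V K x) Ω) := hbot ▸ haE₀
    rw [IntermediateField.mem_bot] at ha
    obtain ⟨c, hc⟩ := ha
    rw [← hc]
    exact c.2
  by_cases hEs : separableClosure (henselizedAdjoin V K x) E₀ = ⊥
  · ------------------------------------------------------------ `E₀|F` purely inseparable
    haveI : IsPurelyInseparable (henselizedAdjoin V K x) E₀ := separableClosure.eq_bot_iff.mp hEs
    rcases CharP.char_is_prime_or_zero Ω (ringChar Ω) with hq | hq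
    · -- characteristic `q > 0`: a first purely inseparable step of degree `q` would be immediate
      haveI : Fact (ringChar Ω).Prime := ⟨hq⟩
      by_contra hE₀ne
      have htow : IsNormalPTower (ringChar Ω) (henselizedAdjoin V K x) E₀.toSubfield :=
        isNormalPTower_of_isPurelyInseparable (p := ringChar Ω) (henselizedAdjoin V K x) E₀
      have hne' : henselizedAdjoin V K x ≠ E₀.toSubfield := by
        intro h
        apply hE₀ne
        refine le_antisymm (fun z hz => ?_) bot_le
        rw [IntermediateField.mem_bot]
        have hz' : z ∈ E₀.toSubfield := hz
        rw [← h] at hz'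
        exact ⟨⟨z, hz'⟩, rfl⟩
      obtain ⟨N', hstep, hN'E₀⟩ := htow.exists_isNormalStep hne'
      haveI : CharP (ResidueField V) (ringChar Ω) := by
        have h0 : ((ringChar Ω : ℕ) : ResidueField V) = 0 :=
          natCast_residueField_eq_zero (V := V) (CharP.cast_eq_zero Ω _)
        rcases (Nat.dvd_prime hq).mp (ringChar.dvd h0) with h1 | h1
        · exact absurd h1 CharP.ringChar_ne_one
        · exact ringChar.of_eq h1
      have hd := isDefectlessExtension_of_isNormalStep_henselizedAdjoin hG hI V hq hK hx hr hstep
      exact not_isDefectlessExtension_of_isImmediateOver hd (IsImmediateOver.mono_right hN'E₀ himm₀)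
        (by rw [hstep.relfinrank_eq]; exact hq.one_lt)
    · -- characteristic `0`: a purely inseparable extension is trivial
      haveI : CharP Ω 0 := ringChar.of_eq hq
      haveI : CharZero Ω := CharP.charP_to_charZero Ω
      haveI : CharZero (henselizedAdjoin V K x) := RingHom.charZero (algebraMap _ Ω)
      haveI : PerfectField (henselizedAdjoin V K x) := PerfectField.ofCharZero
      haveI : Algebra.IsSeparable (henselizedAdjoin V K x) E₀ :=
        Algebra.IsAlgebraic.isSeparable_of_perfectField
      have hsurj := IsPurelyInseparable.surjective_algebraMap_of_isSeparable (henselizedAdjoin V K x) E₀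
      refine le_antisymm (fun z hz => ?_) bot_le
      rw [IntermediateField.mem_bot]
      obtain ⟨c, hc⟩ := hsurj ⟨z, hz⟩
      exact ⟨c, congrArg Subtype.val hc⟩
  · ------------------------------------------------------------ the maximal separable subextension
    set Es := separableClosure (henselizedAdjoin V K x) E₀ with hEsdef
    haveI hfin1 : FiniteDimensional (henselizedAdjoin V K x) (lift Es) :=
      Module.Finite.equiv (liftAlgEquiv Es).toLinearEquiv
    haveI hsep1 : Algebra.IsSeparable (henselizedAdjoin V K x) (lift Es) :=
      Algebra.IsSeparable.of_algHom _ _ (liftAlgEquiv Es).symm.toAlgHom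
    have himm1 : IsImmediateOver V (henselizedAdjoin V K x) (lift Es).toSubfield :=
      IsImmediateOver.mono_right (fun z hz => hE₀E (lift_le Es hz)) himm
    have h1 := eq_bot_of_isImmediateOver_of_isSeparable hHL hG hI hK hx rfl hr (lift Es) himm1
    exact absurd ((lift_injective E₀) (by rw [h1, lift_bot])) hEs


end Assembly

end Literature.AlgebraicGeometry.Resolution
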